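import Mathlib.Analysis.SpecialFunctions.Pow.Real
import Mathlib.Tactic
import HarnessLib

/-!
# Hampton–Jensen 2011, Table 1: the decomposition of the polynomial `Q` (p. 326) — checked

Topic `Literature/Dynamics/NBody`.  PROVED statements only (no named facts): the identity printed in
[HamptonJensen2011] (Celest. Mech. Dyn. Astron. 109 (2011) 321–332) on p. 326, in the paragraph
after Table 1, verbatim: "To obtain the above results in the cases with the exceptional polynomials
`m₁ − m₄`, `m₂ − m₃` we found a decomposition of a certain polynomial that appears in each of the
saturated ideals of those cases …:
`Q = m₁⁶m₂⁶ + 2m₁⁶m₂³m₃³ + m₁⁶m₃⁶ + 2m₁³m₂⁶m₄³ − 12m₁³m₂³m₃³m₄³ + 2m₁³m₃⁶m₄³ + m₂⁶m₄⁶ + 2m₂³m₃³m₄⁶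
+ m₃⁶m₄⁶ = (m₁³ − m₄³)²(m₂³ − m₃³)² + 4m₂³m₃³(m₁³ − m₄³)² + 4m₁³m₄³(m₂³ − m₃³)²`.
This decomposition makes it clear that for real masses `Q = 0` is equivalent to `m₁ = m₄` and
`m₂ = m₃`."

What is checked here (kernel, no `sorry`): (1) the polynomial identity, written in the cubes
`M_i = m_i³` (`hjQ3`), over any commutative ring; (2) for POSITIVE `M_i` (equivalently positive
masses), `Q = 0 ↔ M₁ = M₄ ∧ M₂ = M₃`, and the mass form `m₁ = m₄ ∧ m₂ = m₃` for positive real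
masses; (3) a recorded caveat on the quoted sentence: with REAL masses of mixed sign the
equivalence fails — `Q3(9, 8, −2, −1) = 0` although `9 ≠ −1` (i.e. masses
`(9^{1/3}, 2, −2^{1/3}, −1, m₅)`), so "real" in the quoted sentence must be read as "positive"
(which is all that the paper's Theorem 1 uses).  Used by the `pub-smale6` cell's independent
cross-check of Table 1 (certs/tropical_hj11_prevariety/TABLE1_CROSSCHECK.md).
-/

namespace Literature.Dynamics.NBody

/-- Hampton–Jensen's polynomial `Q` of p. 326 written in the cubes `M_i = m_i³` of the masses
(`Q` is a polynomial in `m₁³, …, m₄³`; `m₅` does not occur). [cite: HamptonJensen2011, p. 326] -/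
def hjQ3 {R : Type*} [CommRing R] (M₁ M₂ M₃ M₄ : R) : R :=
  M₁ ^ 2 * M₂ ^ 2 + 2 * M₁ ^ 2 * M₂ * M₃ + M₁ ^ 2 * M₃ ^ 2 + 2 * M₁ * M₂ ^ 2 * M₄
    - 12 * M₁ * M₂ * M₃ * M₄ + 2 * M₁ * M₃ ^ 2 * M₄ + M₂ ^ 2 * M₄ ^ 2 + 2 * M₂ * M₃ * M₄ ^ 2
    + M₃ ^ 2 * M₄ ^ 2

/-- `Q` as a function of the masses themselves. [cite: HamptonJensen2011, p. 326] -/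
def hjQ {R : Type*} [CommRing R] (m₁ m₂ m₃ m₄ : R) : R := hjQ3 (m₁ ^ 3) (m₂ ^ 3) (m₃ ^ 3) (m₄ ^ 3)

/-- The printed decomposition of `Q` (p. 326), as a ring identity in the cubes.
[cite: HamptonJensen2011, p. 326] -/
theorem hjQ3_decomposition {R : Type*} [CommRing R] (M₁ M₂ M₃ M₄ : R) :
    hjQ3 M₁ M₂ M₃ M₄ =
      (M₁ - M₄) ^ 2 * (M₂ - M₃) ^ 2 + 4 * M₂ * M₃ * (M₁ - M₄) ^ 2
        + 4 * M₁ * M₄ * (M₂ - M₃) ^ 2 := by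
  unfold hjQ3; ring

/-- The printed decomposition in the masses (p. 326, displayed identity, verbatim shape).
[cite: HamptonJensen2011, p. 326] -/
theorem hjQ_decomposition {R : Type*} [CommRing R] (m₁ m₂ m₃ m₄ : R) :
    hjQ m₁ m₂ m₃ m₄ =
      (m₁ ^ 3 - m₄ ^ 3) ^ 2 * (m₂ ^ 3 - m₃ ^ 3) ^ 2 + 4 * m₂ ^ 3 * m₃ ^ 3 * (m₁ ^ 3 - m₄ ^ 3) ^ 2
        + 4 * m₁ ^ 3 * m₄ ^ 3 * (m₂ ^ 3 - m₃ ^ 3) ^ 2 := by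
  unfold hjQ hjQ3; ring

/-- For positive arguments the three summands are nonnegative, so `Q = 0` iff `M₁ = M₄` and
`M₂ = M₃` (the paper's sentence after the decomposition, for positive masses).
[cite: HamptonJensen2011, p. 326] -/
theorem hjQ3_eq_zero_iff_of_pos {M₁ M₂ M₃ M₄ : ℝ} (h₁ : 0 < M₁) (h₂ : 0 < M₂) (h₃ : 0 < M₃)
    (h₄ : 0 < M₄) : hjQ3 M₁ M₂ M₃ M₄ = 0 ↔ M₁ = M₄ ∧ M₂ = M₃ := by
  rw [hjQ3_decomposition]
  constructor
  · intro h
    have t1 : 0 ≤ (M₁ - M₄) ^ 2 * (M₂ - M₃) ^ 2 := by positivity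
    have t2 : 0 ≤ 4 * M₂ * M₃ * (M₁ - M₄) ^ 2 := by positivity
    have t3 : 0 ≤ 4 * M₁ * M₄ * (M₂ - M₃) ^ 2 := by positivity
    have e2 : 4 * M₂ * M₃ * (M₁ - M₄) ^ 2 = 0 := by linarith
    have e3 : 4 * M₁ * M₄ * (M₂ - M₃) ^ 2 = 0 := by linarith
    have a : (M₁ - M₄) ^ 2 = 0 := by
      rcases mul_eq_zero.mp e2 with h | h
      · exfalso; nlinarith
      · exact h
    have b : (M₂ - M₃) ^ 2 = 0 := by
      rcases mul_eq_zero.mp e3 with h | h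
      · exfalso; nlinarith
      · exact h
    exact ⟨by nlinarith [pow_eq_zero_iff (n := 2) (two_ne_zero) |>.mp a],
      by nlinarith [pow_eq_zero_iff (n := 2) (two_ne_zero) |>.mp b]⟩
  · rintro ⟨rfl, rfl⟩; ring

/-- Mass form: for positive real masses, `Q(m) = 0 ↔ m₁ = m₄ ∧ m₂ = m₃` — exactly the Table 1
rows "`m₁ − m₄, m₂ − m₃`" for positive masses. [cite: HamptonJensen2011, p. 326, Table 1] -/
theorem hjQ_eq_zero_iff_of_pos {m₁ m₂ m₃ m₄ : ℝ} (h₁ : 0 < m₁) (h₂ : 0 < m₂) (h₃ : 0 < m₃)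
    (h₄ : 0 < m₄) : hjQ m₁ m₂ m₃ m₄ = 0 ↔ m₁ = m₄ ∧ m₂ = m₃ := by
  unfold hjQ
  rw [hjQ3_eq_zero_iff_of_pos (pow_pos h₁ 3) (pow_pos h₂ 3) (pow_pos h₃ 3) (pow_pos h₄ 3)]
  constructor
  · rintro ⟨a, b⟩
    exact ⟨(pow_left_inj₀ h₁.le h₄.le (by norm_num : (3 : ℕ) ≠ 0)).1 a,
      (pow_left_inj₀ h₂.le h₃.le (by norm_num : (3 : ℕ) ≠ 0)).1 b⟩
  · rintro ⟨rfl, rfl⟩; exact ⟨rfl, rfl⟩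

/-- Caveat on the quoted sentence "for real masses": with mixed signs the equivalence fails already
in the cubes — `Q3(9, 8, −2, −1) = 0` while `9 ≠ −1` and `8 ≠ −2`. [folklore] -/
theorem hjQ3_real_counterexample : hjQ3 (9 : ℚ) 8 (-2) (-1) = 0 ∧ (9 : ℚ) ≠ -1 ∧ (8 : ℚ) ≠ -2 := by
  refine ⟨by norm_num [hjQ3], by norm_num, by norm_num⟩

/-- The same caveat for genuine real masses: `m = (9^{1/3}, 2, −2^{1/3}, −1)` has `Q(m) = 0` and
`m₁ ≠ m₄`. [folklore] -/
theorem hjQ_real_counterexample : ∃ m₁ m₂ m₃ m₄ : ℝ,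
    m₁ ≠ 0 ∧ m₂ ≠ 0 ∧ m₃ ≠ 0 ∧ m₄ ≠ 0 ∧ hjQ m₁ m₂ m₃ m₄ = 0 ∧ m₁ ≠ m₄ := by
  obtain ⟨a, ha⟩ : ∃ a : ℝ, a ^ 3 = 9 :=
    ⟨(9 : ℝ) ^ ((3 : ℕ)⁻¹ : ℝ), by rw [Real.rpow_inv_natCast_pow (by norm_num) (by norm_num)]⟩
  obtain ⟨b, hb⟩ : ∃ b : ℝ, b ^ 3 = 2 :=
    ⟨(2 : ℝ) ^ ((3 : ℕ)⁻¹ : ℝ), by rw [Real.rpow_inv_natCast_pow (by norm_num) (by norm_num)]⟩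
  refine ⟨a, 2, -b, -1, ?_, by norm_num, ?_, by norm_num, ?_, ?_⟩
  · rintro rfl; norm_num at ha
  · intro h; have : b = 0 := by linarith
    subst this; norm_num at hb
  · unfold hjQ
    have h3 : (-b) ^ 3 = -2 := by rw [neg_pow, hb]; norm_num
    rw [ha, h3]; norm_num [hjQ3]
  · rintro h; rw [h] at ha; norm_num at ha

end Literature.Dynamics.NBody
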